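import Summits.MatrixMultiplication.OmegaCensus.STPP211Z2pow5RoomEngine

/-!
# (2,1,1)⁶ in (ℤ/2)⁵ — the X-ROOM CERTIFICATE, part A′: the engine with a restricted first level (chunking)

Cell `pub-omega` (unit `pub-omega-stpp-1-g35`), topic `Summits/MatrixMultiplication/OmegaCensus`.
HONEST FRAMING (verbatim): lottery ticket; floor = certified bounds/negative ranges. Census STRUCTURE bookkeeping (B5, T1 column at `(ℤ/2)⁵`);
nothing here is a bound on `ω`.

`T1Z2p5.goSel sel T ts used F1` is the cons case of `T1Z2p5.go` (`STPP211Z2pow5RoomEngine`) for the first block (table `T`) with the smaller code `a`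
of its pair restricted to the set bits of `sel`; below the first block it continues with `go ts`. Running it on a family of `sel` masks covering all
32 codes is the same search as `go (T :: ts)`, split into kernel-sized chunks (the representative `{0,1,2,4,8,15}` has 882 976 placements — too
many for one `decide +kernel` under the farm's memory ceiling; five chunks of ≤ 2.1·10⁵). Soundness: `STPP211Z2pow5RoomReflectSel`.

References: H. Cohn, R. Kleinberg, B. Szegedy, C. Umans, FOCS 2005 (arXiv:math/0511460), Def. 5.1.
-/

namespace Summit.MatrixMultiplication.OmegaCensus

namespace T1Z2p5

open STPP211Neg

/-- THE FIRST LEVEL RESTRICTED TO `sel`: place the first block (table `T`) as a pair `a < a'` with `a` a set bit of `sel` (all other filters as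
in `go`), then continue with `go ts`. -/
noncomputable def goSel (sel T : ℕ) (ts : List ℕ) (used F1 : ℕ) : Bool :=
  force (cpl (Nat.lor used F1)) fun R =>
  !(hasBits (Nat.mul 2 (Nat.succ (List.length ts))) R) ||
  force (fld T 0) fun P =>
  force (Nat.land R (cpl (spread T used))) fun S =>
  force (Nat.land S sel) fun S1 =>
  allBits S1 (fun a =>
    force (Nat.land S (Nat.xor full5 (lowMask (Nat.add a 1)))) fun S2 =>
    force (Nat.lor F1 (fld T a)) fun F1a =>
    force (Nat.lor used (bit a)) fun Ua =>
    allBits S2 (fun a2 =>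
      Nat.testBit P (Nat.xor a a2) ||
      go ts (Nat.lor Ua (bit a2)) (Nat.lor F1a (fld T a2)))
    S2)
  S1

end T1Z2p5

end Summit.MatrixMultiplication.OmegaCensus
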